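import Summits.MatrixMultiplication.MatrixMultiplication.Theorems.SoloInformedValPureHubRefutation

/-!
# A hub pair whose volume exceeds its four mixed images

Solo-informed MatrixMultiplication, gen 81 (dossier `paper/val-superlinear.md` §15.8 (n)(x), (xiii); CLAIMS c582, c589).

`SoloInformedValMixedImages` proved that for an accidental-free union of two complete blocks with disjoint `J`- and
`K`-classes the mixed images `X₁ + Y₁ - Z₁`, `X₁ + Y₂ - Z₂`, `X₂ + Y₁ - Z₂` are pairwise disjoint, and the seat
conjectured the SUPER-ADDITIVITY inequality `|X₁||Y₁||Z₁| + |X₂||Y₂||Z₂| ≤ |M₁₁₁ ∪ M₂₂₂ ∪ M₁₂₁ ∪ M₂₁₂|`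
(`M_abc = X_a + Y_b - Z_c`), which would have given the packing bound `T ≤ |G|` for hub pairs.  This file records in
the kernel that the inequality is FALSE, even for hub pairs: in `ZMod 40` the blocks

  `X₁ = {7, 17, 27, 37}`, `Y₁ = {8, 16, 24, 32}`, `Z₁ = {0}` and `X₂ = {31, 39, 7, 23}`, `Y₂ = {1, 11, 21}`, `Z₂ = {31}`

(common hub row `7`, disjoint `Y`- and `Z`-classes) form an accidental-free union (`witness40_noAccidental`) with
total volume `16 + 12 = 28` but only `27` elements in the union of the four mixed images
(`witness40_card_mixedImages`); the packing bound itself is respected (`28 ≤ 40`).  The verification is a finite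
computation: `noAccidental_iff_forall_mem` rewrites accidental-freeness as a statement quantified over the three
(finite) pair graphs, which `decide` then checks (`28 · 7 · 8 = 1568` edge triples).  No `sorry`.
-/

namespace Summit.MatrixMultiplication.MatrixMultiplication.Theorems.SoloVal

open Finset

section BoundedForm

variable {G : Type*} [AddCommGroup G]
variable {I J K : Type*}

/-- Accidental-freeness as a statement quantified over the three pair graphs (a finite check when the graphs are
explicit finsets). -/
theorem noAccidental_iff_forall_mem (x : I → G) (y : J → G) (z : K → G)
    (HIJ : Finset (I × J)) (HJK : Finset (J × K)) (HKI : Finset (K × I)) :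
    NoAccidental x y z HIJ HJK HKI ↔
      ∀ e₁ ∈ HIJ, ∀ e₂ ∈ HJK, ∀ e₃ ∈ HKI,
        (x e₁.1 - y e₁.2) + (y e₂.1 - z e₂.2) + (z e₃.1 - x e₃.2) = 0 →
          e₁.1 = e₃.2 ∧ e₁.2 = e₂.1 ∧ e₂.2 = e₃.1 := by
  constructor
  · rintro h ⟨i, j⟩ h₁ ⟨j', k⟩ h₂ ⟨k', i'⟩ h₃ h0
    exact h i j j' k k' i' h₁ h₂ h₃ h0
  · intro h i j j' k k' i' h₁ h₂ h₃ h0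
    exact h (i, j) h₁ (j', k) h₂ (k', i') h₃ h0

end BoundedForm

section Witness40

/-- Rows of block 1 of the `ZMod 40` witness (a coset of `⟨10⟩`). -/
def wX₁ : Finset (ZMod 40) := {7, 17, 27, 37}
/-- Columns of block 1 of the `ZMod 40` witness. -/
def wY₁ : Finset (ZMod 40) := {8, 16, 24, 32}
/-- The single `K`-class of block 1 of the `ZMod 40` witness. -/
def wZ₁ : Finset (ZMod 40) := {0}
/-- Rows of block 2 of the `ZMod 40` witness (shares the hub row `7` with block 1). -/
def wX₂ : Finset (ZMod 40) := {31, 39, 7, 23}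
/-- Columns of block 2 of the `ZMod 40` witness. -/
def wY₂ : Finset (ZMod 40) := {1, 11, 21}
/-- The single `K`-class of block 2 of the `ZMod 40` witness. -/
def wZ₂ : Finset (ZMod 40) := {31}

/-- The witness is an accidental-free union of two complete blocks (identity potentials). -/
theorem witness40_noAccidental :
    NoAccidental (id : ZMod 40 → ZMod 40) id id (blockPairs wX₁ wY₁ wX₂ wY₂) (blockPairs wY₁ wZ₁ wY₂ wZ₂)
      (blockPairs wZ₁ wX₁ wZ₂ wX₂) := by
  rw [noAccidental_iff_forall_mem]
  decide +kernel

/-- The witness is a hub pair: common row `7`, disjoint `Y`-classes, disjoint `Z`-classes. -/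
theorem witness40_hub : (7 : ZMod 40) ∈ wX₁ ∧ (7 : ZMod 40) ∈ wX₂ ∧ Disjoint wY₁ wY₂ ∧ Disjoint wZ₁ wZ₂ := by
  decide

/-- Total volume `28`, but the four mixed images `X₁+Y₁-Z₁`, `X₂+Y₂-Z₂`, `X₁+Y₂-Z₁`, `X₂+Y₁-Z₂` cover only `27`
elements of `ZMod 40`: super-additivity fails for this hub pair (while `28 ≤ 40 = |G|`). -/
theorem witness40_card_mixedImages :
    wX₁.card * wY₁.card * wZ₁.card + wX₂.card * wY₂.card * wZ₂.card = 28 ∧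
      (mixedImage wX₁ wY₁ wZ₁ ∪ mixedImage wX₂ wY₂ wZ₂ ∪ mixedImage wX₁ wY₂ wZ₁ ∪
        mixedImage wX₂ wY₁ wZ₂).card = 27 := by
  decide +kernel

/-- Hence no inequality `|X₁||Y₁||Z₁| + |X₂||Y₂||Z₂| ≤ |M₁₁₁ ∪ M₂₂₂ ∪ M₁₂₁ ∪ M₂₁₂|` holds for hub pairs in
general. -/
theorem not_superAdditive_hubPairs :
    ¬ ∀ (X₁ Y₁ Z₁ X₂ Y₂ Z₂ : Finset (ZMod 40)) (h : ZMod 40), h ∈ X₁ → h ∈ X₂ → Disjoint Y₁ Y₂ → Disjoint Z₁ Z₂ →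
      NoAccidental (id : ZMod 40 → ZMod 40) id id (blockPairs X₁ Y₁ X₂ Y₂) (blockPairs Y₁ Z₁ Y₂ Z₂)
        (blockPairs Z₁ X₁ Z₂ X₂) →
      X₁.card * Y₁.card * Z₁.card + X₂.card * Y₂.card * Z₂.card ≤
        (mixedImage X₁ Y₁ Z₁ ∪ mixedImage X₂ Y₂ Z₂ ∪ mixedImage X₁ Y₂ Z₁ ∪ mixedImage X₂ Y₁ Z₂).card := by
  intro h
  have h28 := h wX₁ wY₁ wZ₁ wX₂ wY₂ wZ₂ 7 witness40_hub.1 witness40_hub.2.1 witness40_hub.2.2.1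
    witness40_hub.2.2.2 witness40_noAccidental
  rw [witness40_card_mixedImages.1, witness40_card_mixedImages.2] at h28
  omega

end Witness40

end Summit.MatrixMultiplication.MatrixMultiplication.Theorems.SoloVal
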